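import Literature.NumberTheory.LFunctions.MoebiusCharSumLinnikBoxBounds
import Literature.NumberTheory.LFunctions.PerronFormulaShifted
import HarnessLib

/-!
# Twisted Möbius sums from a zero-free Linnik box: `∑_{n ≤ N} χ(n)μ(n) ≪ N (log x)^{-B}`

Topic `Literature/NumberTheory/LFunctions`. Everything in this file is PROVED.

**Theorem** (`MoebiusCharSumLinnikBox.norm_sum_le`). For every `B ≥ 0` there is `x₀` such that
for `x ≥ x₀`, `L = log x`, every modulus `q ≤ x^{1/16}`, every NON-PRINCIPAL character `χ` mod `q`
whose `L(s, χ)` has no zero in the box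
`1 − (200B + 1000) log L/L < Re s < 1`, `|Im s| ≤ L^{3B+12}`, and every integer
`x^{2/5} ≤ N ≤ x²`:

`‖∑_{n ≤ N} χ(n) μ(n)‖ ≤ N / L^B`.

This is Linnik's "explicit formula with a wide zero-free box" step (Iwaniec–Kowalski §18.2;
Bombieri, *Le grand crible*, §6) done for `μχ` via `1/L`: truncated Perron at `c = 1 + 1/log x'`
(`x' = N + 1/2`, height `T = L^H/2`) and Cauchy's theorem down to `Re s = 1 − η/2`,
`η = K log L/L` (`PerronShift.norm_sum_le`), with `1/L(s, χ)` controlled on the contour by the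
Borel–Carathéodory bounds of `MoebiusCharSumLinnikBoxBounds.lean`: the box is `K log L`
classical widths wide, so `x'^{−η/2} = L^{−(K/2)(log x'/L)}` beats both the loss
`exp(O((K/16 + H) log L))` of `1/L` and the height `T`, for `K = 200B + 1000`, `H = 3B + 12`.
No Siegel-zero dichotomy arises: the hypothesis excludes all zeros in the box.

## References

* [IwaniecKowalski2004] H. Iwaniec, E. Kowalski, *Analytic Number Theory*, AMS 2004, §18.2.
* [Bombieri1987GrandCrible] E. Bombieri, *Le grand crible dans la théorie analytique des nombres*,
  Astérisque 18 (1987), §6.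
* [MontgomeryVaughan2007] H. L. Montgomery, R. C. Vaughan, *Multiplicative Number Theory I*,
  CUP 2007, Cor. 5.3, §6.2, §11.3 Exercise 8.
-/

noncomputable section

open Complex Filter Topology Metric Set
open scoped ArithmeticFunction.Moebius

namespace Literature.NumberTheory.LFunctions

namespace MoebiusCharSumLinnikBox

/-! ### The three pieces of the contour bound are `≤ x' e^{-(B+1)ℓ}` -/

/-- The Perron truncation term: `K₀ x' log x'/T ≤ x' e^{-(B+1)ℓ}` (`T = L^H/2`, `H = 3B + 12`,
`log x' ≤ 2.1 L`, `4.2 K₀ ≤ L`). [folklore] -/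
theorem piece_one {B H K₀ ℓ L T x' lx : ℝ} (hH : H = 3 * B + 12) (hB : 0 ≤ B)
    (hLexp : L = Real.exp ℓ) (hT : T = Real.exp (H * ℓ) / 2) (hK₀L : 5 * K₀ ≤ L) (hK₀ : 0 < K₀)
    (hx'0 : 0 < x') (hlx2 : lx ≤ 21 / 10 * L) (hℓ0 : 0 < ℓ) :
    K₀ * x' * lx / T ≤ x' * Real.exp (-(B + 1) * ℓ) := by
  have hT0 : 0 < T := by rw [hT]; positivity
  have hL0 : 0 < L := by rw [hLexp]; exact Real.exp_pos ℓ
  rw [div_le_iff₀ hT0, hT]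
  have h2 : 42 / 10 * K₀ * L ≤ Real.exp (-(B + 1) * ℓ) * Real.exp (H * ℓ) := by
    rw [← Real.exp_add, show -(B + 1) * ℓ + H * ℓ = ℓ + (2 * B + 10) * ℓ by rw [hH]; ring,
      Real.exp_add, ← hLexp]
    have h3 : 42 / 10 * K₀ ≤ Real.exp ((2 * B + 10) * ℓ) := by
      calc 42 / 10 * K₀ ≤ L := by linarith
        _ = Real.exp ℓ := hLexp
        _ ≤ Real.exp ((2 * B + 10) * ℓ) := Real.exp_le_exp.2 (by nlinarith)
    nlinarith
  have h1 : K₀ * x' * lx ≤ K₀ * x' * (21 / 10 * L) := mul_le_mul_of_nonneg_left hlx2 (by positivity)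
  have h4 : x' * (42 / 10 * K₀ * L) ≤ x' * (Real.exp (-(B + 1) * ℓ) * Real.exp (H * ℓ)) :=
    mul_le_mul_of_nonneg_left h2 hx'0.le
  linarith

/-- The left edge: `T V x'^{σ₀}/σ₀ ≤ x' e^{-(B+1)ℓ}`, where `V = exp((4a+2)M + 4(ℓ+12))`,
`x'^{σ₀} = x' · x'^{-η/2} ≤ x' e^{-Kℓ/5}`. [folklore] -/
theorem piece_two {B K H ℓ L T V x' σ₀ η a Mb : ℝ} (hT : T = Real.exp (H * ℓ) / 2)
    (hV : V = Real.exp ((4 * a + 2) * Mb + 4 * (ℓ + 12))) (hσ₀ : σ₀ = 1 - η / 2)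
    (hσ₀0 : 0 < σ₀) (hσ₀2 : 1 / 2 ≤ σ₀) (hx'0 : 0 < x') (hlx1 : 2 / 5 * L ≤ Real.log x')
    (hηL : η * L = K * ℓ) (hη0 : 0 < η)
    (hE2 : H * ℓ + (4 * a + 2) * Mb + 4 * (ℓ + 12) - K * ℓ / 5 + (B + 1) * ℓ ≤ 0) :
    T * V * x' ^ σ₀ / σ₀ ≤ x' * Real.exp (-(B + 1) * ℓ) := by
  have h1 : x' ^ σ₀ ≤ x' * Real.exp (-(K * ℓ / 5)) := by
    rw [Real.rpow_def_of_pos hx'0, hσ₀, show Real.log x' * (1 - η / 2) =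
      Real.log x' + -(η / 2 * Real.log x') by ring, Real.exp_add, Real.exp_log hx'0]
    refine mul_le_mul_of_nonneg_left (Real.exp_le_exp.2 ?_) hx'0.le
    have : η / 2 * (2 / 5 * L) ≤ η / 2 * Real.log x' := mul_le_mul_of_nonneg_left hlx1 (by positivity)
    rw [show η / 2 * (2 / 5 * L) = η * L / 5 by ring, hηL] at this
    linarith
  have hTV : 0 ≤ T * V := by rw [hT, hV]; positivity
  have h2 : T * V * x' ^ σ₀ / σ₀ ≤ T * V * (x' * Real.exp (-(K * ℓ / 5))) * 2 := by
    rw [div_le_iff₀ hσ₀0]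
    have h3 : T * V * x' ^ σ₀ ≤ T * V * (x' * Real.exp (-(K * ℓ / 5))) :=
      mul_le_mul_of_nonneg_left h1 hTV
    have h4 : 0 ≤ T * V * (x' * Real.exp (-(K * ℓ / 5))) := by positivity
    nlinarith
  refine h2.trans ?_
  rw [hT, hV]
  have e : Real.exp (H * ℓ + ((4 * a + 2) * Mb + 4 * (ℓ + 12)) + -(K * ℓ / 5)) =
      Real.exp (H * ℓ) * Real.exp ((4 * a + 2) * Mb + 4 * (ℓ + 12)) *
        Real.exp (-(K * ℓ / 5)) := by
    rw [Real.exp_add, Real.exp_add]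
  have e2 : Real.exp (H * ℓ) / 2 * Real.exp ((4 * a + 2) * Mb + 4 * (ℓ + 12)) *
      (x' * Real.exp (-(K * ℓ / 5))) * 2 =
      x' * (Real.exp (H * ℓ) * Real.exp ((4 * a + 2) * Mb + 4 * (ℓ + 12)) *
        Real.exp (-(K * ℓ / 5))) := by ring
  rw [e2, ← e]
  exact mul_le_mul_of_nonneg_left (Real.exp_le_exp.2 (by linarith)) hx'0.le

/-- The horizontal edges: `(c − σ₀) W/T ≤ x' e^{-(B+1)ℓ}`, where
`W = x' exp(2.1 aKℓ + 4(ℓ+12))`, `c − σ₀ = 1/log x' + η/2 ≤ Kℓ/L`. [folklore] -/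
theorem piece_three {B K H ℓ L T W x' c σ₀ η a : ℝ} (hT : T = Real.exp (H * ℓ) / 2)
    (hW : W = x' * Real.exp (21 / 10 * a * K * ℓ + 4 * (ℓ + 12))) (hc : c = 1 + 1 / Real.log x')
    (hσ₀ : σ₀ = 1 - η / 2) (hlx1 : 2 / 5 * L ≤ Real.log x') (hL0 : 0 < L) (hLexp : L = Real.exp ℓ)
    (hηL : η * L = K * ℓ) (hKℓ5 : 5 ≤ K * ℓ) (hx'0 : 0 < x')
    (hE3 : Real.log (2 * K * ℓ) - ℓ + 21 / 10 * a * K * ℓ + 4 * (ℓ + 12) - H * ℓ +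
      (B + 1) * ℓ ≤ 0) :
    (c - σ₀) * W / T ≤ x' * Real.exp (-(B + 1) * ℓ) := by
  have hT0 : 0 < T := by rw [hT]; positivity
  have hlx0 : 0 < Real.log x' := by linarith
  have h1 : c - σ₀ ≤ K * ℓ * Real.exp (-ℓ) := by
    have e1 : K * ℓ * Real.exp (-ℓ) = K * ℓ / L := by rw [Real.exp_neg, ← hLexp]; ring
    rw [e1, hc, hσ₀, le_div_iff₀ hL0]
    have h2 : 1 / Real.log x' * L ≤ 5 / 2 := by
      rw [div_mul_eq_mul_div, one_mul, div_le_iff₀ hlx0]; linarith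
    have h3 : η / 2 * L = K * ℓ / 2 := by rw [show η / 2 * L = η * L / 2 by ring, hηL]
    nlinarith
  have hW0 : 0 ≤ W := by rw [hW]; positivity
  have hKℓ0 : 0 < 2 * K * ℓ := by linarith
  have hE0 : Real.exp (H * ℓ) ≠ 0 := (Real.exp_pos _).ne'
  calc (c - σ₀) * W / T ≤ K * ℓ * Real.exp (-ℓ) * W / T := by gcongr
    _ = x' * ((2 * K * ℓ) * (Real.exp (-ℓ) * Real.exp (21 / 10 * a * K * ℓ + 4 * (ℓ + 12)) *
          (Real.exp (H * ℓ))⁻¹)) := by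
        rw [hW, hT]; ring
    _ = x' * Real.exp (Real.log (2 * K * ℓ) +
          (-ℓ + (21 / 10 * a * K * ℓ + 4 * (ℓ + 12)) + -(H * ℓ))) := by
        simp only [Real.exp_add, Real.exp_neg, Real.exp_log hKℓ0]
    _ ≤ x' * Real.exp (-(B + 1) * ℓ) :=
        mul_le_mul_of_nonneg_left (Real.exp_le_exp.2 (by linarith)) hx'0.le

/-- `3 x' e^{-(B+1)ℓ} ≤ N/L^B` for `x' = N + 1/2`, `N ≥ 3`, `L = e^ℓ ≥ 16`. [folklore] -/
theorem final_step {B ℓ L x' : ℝ} {N : ℕ} (hx' : x' = N + 1 / 2) (hN3 : (3 : ℝ) ≤ N)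
    (hL16 : 16 ≤ L) (hLexp : L = Real.exp ℓ) (hL0 : 0 < L) :
    x' * Real.exp (-(B + 1) * ℓ) * 3 ≤ N / L ^ B := by
  have hℓ : Real.log L = ℓ := by rw [hLexp, Real.log_exp]
  have hLB : L ^ B = Real.exp (B * ℓ) := by rw [Real.rpow_def_of_pos hL0, hℓ, mul_comm]
  have h : Real.exp (-(B + 1) * ℓ) * Real.exp (B * ℓ) = L⁻¹ := by
    rw [← Real.exp_add, show -(B + 1) * ℓ + B * ℓ = -ℓ by ring, Real.exp_neg, ← hLexp]
  rw [hLB, le_div_iff₀ (Real.exp_pos _)]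
  calc x' * Real.exp (-(B + 1) * ℓ) * 3 * Real.exp (B * ℓ)
      = 3 * x' * (Real.exp (-(B + 1) * ℓ) * Real.exp (B * ℓ)) := by ring
    _ = 3 * x' / L := by rw [h, div_eq_mul_inv]
    _ ≤ N := by rw [hx', div_le_iff₀ hL0]; nlinarith

/-! ### The horizontal majorant -/

section Horizontal

variable {q : ℕ} [NeZero q] (χ : DirichletCharacter ℂ q)

/-- On the horizontal edges `σ₀ ≤ σ ≤ c`: `‖L(σ + it, χ)⁻¹‖ x'^σ ≤ W = x' exp(2.1 aKℓ + 4(ℓ+12))`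
(Borel–Carathéodory for `σ ≤ 1 + aη`, the trivial bound beyond). [cite: IwaniecKowalski2004, §18.2] -/
theorem horizontal_le (hχ : χ ≠ 1) {η a t K ℓ L Mb x' c : ℝ} (hη0 : 0 < η) (hη4 : η ≤ 1 / 4)
    (ha0 : 0 < a) (ha4 : a ≤ 1 / 4)
    (hdisc : ∀ w : ℂ, ‖w - (1 + a * η + t * I)‖ < (1 + a) * η → w.re < 1 → χ.LFunction w ≠ 0)
    (hMt : 2 + η * Real.log q + Real.log (|t| + 2) + Real.log (Real.log q + 5) ≤ Mb)
    (hcb : Real.log (2 / (a * η)) + Real.pi ≤ ℓ + 12) (hx'0 : 0 < x')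
    (hlog4M : 4 * Mb / η ≤ Real.log x') (hlx2 : Real.log x' ≤ 21 / 10 * L) (hηL : η * L = K * ℓ)
    (hKℓ : 0 ≤ K * ℓ) (hx'1 : 1 ≤ x') (hx'c : x' ^ c = Real.exp 1 * x')
    {σ : ℝ} (hσ1 : 1 - η / 2 ≤ σ) (hσ2 : σ ≤ c) :
    ‖(χ.LFunction (σ + t * I))⁻¹‖ * x' ^ σ ≤
      x' * Real.exp (21 / 10 * a * K * ℓ + 4 * (ℓ + 12)) := by
  have haηx : a * η * Real.log x' ≤ 21 / 10 * a * K * ℓ := by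
    calc a * η * Real.log x' ≤ a * η * (21 / 10 * L) :=
          mul_le_mul_of_nonneg_left hlx2 (by positivity)
      _ = 21 / 10 * a * (η * L) := by ring
      _ = 21 / 10 * a * K * ℓ := by rw [hηL]; ring
  rcases le_or_gt σ (1 + a * η) with hσ3 | hσ3
  · refine (norm_inv_mul_rpow_le χ hχ hη0 hη4 ha0 ha4 hdisc hMt hcb hx'0 hlog4M hσ1 hσ3).trans ?_
    exact mul_le_mul_of_nonneg_left (Real.exp_le_exp.2 (by linarith)) hx'0.le
  · have haη0 : 0 < a * η := by positivity
    have haη1 : a * η ≤ 1 := by nlinarith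
    have h1 := norm_inv_le_of_gt χ (t := t) haη0 haη1 hσ3.le
    have h2 : x' ^ σ ≤ Real.exp 1 * x' := by
      rw [← hx'c]; exact Real.rpow_le_rpow_of_exponent_le hx'1 hσ2
    have h3 : 2 / (a * η) ≤ Real.exp (ℓ + 12) := by
      have : Real.log (2 / (a * η)) ≤ ℓ + 12 := by linarith [Real.pi_pos.le]
      calc 2 / (a * η) = Real.exp (Real.log (2 / (a * η))) := (Real.exp_log (by positivity)).symm
        _ ≤ Real.exp (ℓ + 12) := Real.exp_le_exp.2 this
    have hℓ12 : 3 ≤ ℓ + 12 := by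
      have : (0 : ℝ) ≤ Real.log (2 / (a * η)) :=
        Real.log_nonneg (by rw [le_div_iff₀ haη0]; linarith)
      linarith [Real.pi_gt_three]
    calc ‖(χ.LFunction (σ + t * I))⁻¹‖ * x' ^ σ ≤ 2 / (a * η) * (Real.exp 1 * x') :=
          mul_le_mul h1 h2 (Real.rpow_nonneg hx'0.le _) (by positivity)
      _ ≤ Real.exp (ℓ + 12) * (Real.exp 1 * x') := mul_le_mul_of_nonneg_right h3 (by positivity)
      _ = x' * Real.exp (ℓ + 12 + 1) := by rw [Real.exp_add _ 1]; ring
      _ ≤ x' * Real.exp (21 / 10 * a * K * ℓ + 4 * (ℓ + 12)) := by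
          refine mul_le_mul_of_nonneg_left (Real.exp_le_exp.2 ?_) hx'0.le
          have : 0 ≤ 21 / 10 * a * K * ℓ := by
            have := mul_nonneg ha0.le hKℓ; nlinarith
          linarith

end Horizontal

/-! ### The theorem -/

/-- **Twisted Möbius sums from a zero-free Linnik box.** For `B ≥ 0` there is `x₀` such that for
`x ≥ x₀`, `q ≤ x^{1/16}`, `χ ≠ χ₀` mod `q` with `L(s, χ) ≠ 0` on
`1 − (200B+1000) log log x/log x < Re s < 1`, `|Im s| ≤ (log x)^{3B+12}`, and integers
`x^{2/5} ≤ N ≤ x²`: `‖∑_{n ≤ N} χ(n)μ(n)‖ ≤ N/(log x)^B`. [cite: IwaniecKowalski2004, §18.2] -/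
theorem norm_sum_le {B : ℝ} (hB : 0 ≤ B) :
    ∃ x₀ : ℝ, ∀ x : ℝ, x₀ ≤ x → ∀ (q : ℕ) [NeZero q], (q : ℝ) ≤ x ^ (1 / 16 : ℝ) →
      ∀ χ : DirichletCharacter ℂ q, χ ≠ 1 →
        (∀ z : ℂ, 1 - (200 * B + 1000) * Real.log (Real.log x) / Real.log x < z.re →
          |z.im| ≤ Real.log x ^ (3 * B + 12) → z.re < 1 → χ.LFunction z ≠ 0) →
        ∀ N : ℕ, x ^ (2 / 5 : ℝ) ≤ N → (N : ℝ) ≤ x ^ 2 →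
          ‖∑ n ∈ Finset.Icc 1 N, χ (n : ZMod q) * (μ n : ℂ)‖ ≤ N / Real.log x ^ B := by
  obtain ⟨K₀, hK₀0, hPerron⟩ := PerronShift.norm_sum_le
  obtain ⟨K, hK⟩ : ∃ K : ℝ, K = 200 * B + 1000 := ⟨_, rfl⟩
  obtain ⟨H, hH⟩ : ∃ H : ℝ, H = 3 * B + 12 := ⟨_, rfl⟩
  refine ⟨Real.exp (Real.exp (16 * K + 5 * K₀ + 420)), fun x hx q _ hq χ hχ hbox N hN1 hN2 ↦ ?_⟩
  rw [← hK, ← hH] at hbox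
  -- the parameters `L = log x`, `ℓ = log L`, `η = Kℓ/L`, `T = L^H/2`
  have hx0 : 0 < x := (Real.exp_pos _).trans_le hx
  obtain ⟨L, hLdef⟩ : ∃ L : ℝ, L = Real.log x := ⟨_, rfl⟩
  have hLℓ₀ : Real.exp (16 * K + 5 * K₀ + 420) ≤ L := by
    rw [hLdef, ← Real.log_exp (Real.exp _)]; exact Real.log_le_log (Real.exp_pos _) hx
  have hL0 : 0 < L := (Real.exp_pos _).trans_le hLℓ₀
  obtain ⟨ℓ, hℓdef⟩ : ∃ ℓ : ℝ, ℓ = Real.log L := ⟨_, rfl⟩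
  have hℓ : 16 * K + 5 * K₀ + 420 ≤ ℓ := by
    rw [hℓdef, ← Real.log_exp (16 * K + 5 * K₀ + 420)]
    exact Real.log_le_log (Real.exp_pos _) hLℓ₀
  have hLexp : L = Real.exp ℓ := by rw [hℓdef, Real.exp_log hL0]
  obtain ⟨hL16, ⟨hη0, hη4⟩, hKℓ5, hlogT, hlogL, hcη, hMK, hK₀L, hE2, hE3⟩ :=
    numerics hB hK hH hK₀0 hℓ hLexp
  obtain ⟨η, hηdef⟩ : ∃ η : ℝ, η = K * ℓ / L := ⟨_, rfl⟩
  rw [← hηdef] at hη0 hη4 hcη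
  obtain ⟨a, ha⟩ : ∃ a : ℝ, a = 1 / 1000 := ⟨_, rfl⟩
  rw [← ha] at hcη hE2 hE3
  have ha0 : 0 < a := by rw [ha]; norm_num
  have ha4 : a ≤ 1 / 4 := by rw [ha]; norm_num
  have hηL : η * L = K * ℓ := by rw [hηdef]; field_simp
  have hLH : L ^ H = Real.exp (H * ℓ) := by rw [Real.rpow_def_of_pos hL0, ← hℓdef, mul_comm]
  obtain ⟨T, hTdef⟩ : ∃ T : ℝ, T = Real.exp (H * ℓ) / 2 := ⟨_, rfl⟩
  rw [← hTdef] at hlogT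
  have hH1 : 1 ≤ H := by rw [hH]; linarith
  have hK0 : 0 < K := by rw [hK]; linarith
  have hℓpos : 0 < ℓ := by linarith only [hℓ, hK0, hK₀0]
  have hexpH : L ≤ Real.exp (H * ℓ) := by
    rw [hLexp]; exact Real.exp_le_exp.2 (by nlinarith only [hH1, hℓpos])
  have hT1 : 1 ≤ T := by rw [hTdef]; linarith only [hexpH, hL16]
  have hT0 : 0 < T := by linarith only [hT1]
  have hTH : T + 1 ≤ L ^ H := by rw [hLH, hTdef]; linarith only [hexpH, hL16]
  -- `N ≥ 3`, `x' = N + 1/2`, `c = 1 + 1/log x'`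
  have hx1 : 1 ≤ x := by
    rw [← Real.exp_zero]; exact (Real.exp_le_exp.2 (Real.exp_pos _).le).trans hx
  have hN3r : (3 : ℝ) ≤ N := by
    refine le_trans ?_ hN1
    rw [Real.rpow_def_of_pos hx0, ← hLdef]
    have := Real.add_one_le_exp (L * (2 / 5))
    linarith only [this, hL16]
  have hN3 : 3 ≤ N := by exact_mod_cast hN3r
  obtain ⟨x', hx'⟩ : ∃ x' : ℝ, x' = N + 1 / 2 := ⟨_, rfl⟩
  obtain ⟨c, hc⟩ : ∃ c : ℝ, c = 1 + 1 / Real.log x' := ⟨_, rfl⟩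
  obtain ⟨hx'0, hlogx'1, hc1, _, hx'c, _⟩ := halfInt_facts hN3 hx' hc
  have hlx1 : 2 / 5 * L ≤ Real.log x' := by
    have h1 : Real.log (x ^ (2 / 5 : ℝ)) ≤ Real.log x' :=
      Real.log_le_log (Real.rpow_pos_of_pos hx0 _) (hN1.trans (by rw [hx']; linarith only))
    rw [Real.log_rpow hx0, ← hLdef] at h1
    linarith only [h1]
  have hlx2 : Real.log x' ≤ 21 / 10 * L := by
    have hx2 : (1 : ℝ) ≤ x ^ 2 := one_le_pow₀ hx1
    have h1 : x' ≤ 2 * x ^ 2 := by rw [hx']; linarith only [hx2, hN2]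
    have h2 : Real.log (2 * x ^ 2) = Real.log 2 + 2 * L := by
      rw [Real.log_mul (by norm_num) (by positivity), Real.log_pow, hLdef]; ring
    have h3 : Real.log 2 ≤ 1 := by have := Real.log_two_lt_d9; linarith only [this]
    have h4 := Real.log_le_log hx'0 h1
    linarith only [h2, h3, h4, hL16]
  -- the left abscissa
  obtain ⟨σ₀, hσ₀⟩ : ∃ σ₀ : ℝ, σ₀ = 1 - η / 2 := ⟨_, rfl⟩
  have hσ₀0 : 0 < σ₀ := by rw [hσ₀]; linarith only [hη4]
  have hσ₀1 : σ₀ ≤ 1 := by rw [hσ₀]; linarith only [hη0]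
  have hσ₀2 : 1 / 2 ≤ σ₀ := by rw [hσ₀]; linarith only [hη4]
  have hσ₀c : σ₀ ≤ c := by linarith only [hσ₀1, hc1]
  -- zero-freeness on the rectangle and on the discs, from the box
  have hbox' : ∀ z : ℂ, 1 - η < z.re → |z.im| ≤ L ^ H → z.re < 1 → χ.LFunction z ≠ 0 := by
    intro z h1 h2 h3
    refine hbox z ?_ (by rw [← hLdef]; exact h2) h3
    rw [← hLdef, ← hℓdef, ← hηdef]; exact h1
  have hrect : ∀ s ∈ uIcc σ₀ c ×ℂ uIcc (-T) T, χ.LFunction s ≠ 0 := by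
    intro s hs
    rw [mem_reProdIm, uIcc_of_le hσ₀c, uIcc_of_le (by linarith only [hT0]), mem_Icc, mem_Icc] at hs
    rcases lt_or_ge s.re 1 with h1 | h1
    · have h2 := hs.1.1
      rw [hσ₀] at h2
      exact hbox' s (by linarith only [h2, hη0]) ((abs_le.2 hs.2).trans (by linarith only [hTH]))
        h1
    · exact DirichletCharacter.LFunction_ne_zero_of_one_le_re χ (Or.inl hχ) h1
  have hdisc : ∀ t : ℝ, |t| ≤ T → ∀ w : ℂ, ‖w - (1 + a * η + t * I)‖ < (1 + a) * η →
      w.re < 1 → χ.LFunction w ≠ 0 := by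
    intro t ht w hw hw1
    obtain ⟨hwre, -⟩ := InvLFunctionDisc.re_norm_of_mem_disc hη0 hη4 ha0 (by linarith only [ha4]) hw
    have hwim := abs_im_lt_of_mem_disc hw
    refine hbox' w hwre ?_ hw1
    have : (1 + a) * η ≤ 1 := by nlinarith only [ha0, ha4, hη0, hη4]
    linarith only [hwim, ht, hTH, this]
  -- the holomorphic `F = 1/L` on the rectangle and the Dirichlet series on `Re s = c`
  have hFd : DifferentiableOn ℂ (fun s ↦ (χ.LFunction s)⁻¹) (uIcc σ₀ c ×ℂ uIcc (-T) T) :=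
    ((DirichletCharacter.differentiable_LFunction hχ).differentiableOn.inv hrect)
  have hLF : ∀ t : ℝ, LSeries (fun n : ℕ ↦ χ (n : ZMod q) * (μ n : ℂ)) (c + t * I) =
      (fun s ↦ (χ.LFunction s)⁻¹) (c + t * I) :=
    fun t ↦ MoebiusTwist.LSeries_twist_moebius_eq_inv χ (by simpa using hc1)
  -- the majorants `M_t ≤ Mb`, `4 Mb/η ≤ log x'`
  obtain ⟨Mb, hMb⟩ : ∃ Mb : ℝ, Mb = 2 + K * ℓ / 16 + H * ℓ + ℓ := ⟨_, rfl⟩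
  have hq1 : (1 : ℝ) ≤ q := by exact_mod_cast NeZero.one_le
  have hlogq : Real.log q ≤ L / 16 := by
    calc Real.log q ≤ Real.log (x ^ (1 / 16 : ℝ)) := Real.log_le_log (by linarith) hq
      _ = L / 16 := by rw [Real.log_rpow hx0, ← hLdef]; ring
  have hMt : ∀ t : ℝ, |t| ≤ T →
      2 + η * Real.log q + Real.log (|t| + 2) + Real.log (Real.log q + 5) ≤ Mb := by
    intro t ht
    have h1 : η * Real.log q ≤ K * ℓ / 16 := by
      calc η * Real.log q ≤ η * (L / 16) := mul_le_mul_of_nonneg_left hlogq hη0.le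
        _ = K * ℓ / 16 := by rw [show η * (L / 16) = η * L / 16 by ring, hηL]
    have h2 : Real.log (|t| + 2) ≤ H * ℓ :=
      (Real.log_le_log (by positivity) (by linarith only [ht])).trans hlogT
    have h3 : Real.log (Real.log q + 5) ≤ ℓ :=
      (Real.log_le_log (by linarith only [Real.log_nonneg hq1]) (by linarith only [hlogq])).trans
        hlogL
    rw [hMb]; linarith only [h1, h2, h3]
  have hlog4M : 4 * Mb / η ≤ Real.log x' := by
    refine le_trans ?_ hlx1
    rw [div_le_iff₀ hη0, show 2 / 5 * L * η = 2 / 5 * (η * L) by ring, hηL]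
    rw [hMb]; linarith only [hMK]
  -- Perron with the contour moved to `Re s = σ₀`
  obtain ⟨W, hW⟩ : ∃ W : ℝ, W = x' * Real.exp (21 / 10 * a * K * ℓ + 4 * (ℓ + 12)) :=
    ⟨_, rfl⟩
  have hWb : ∀ t : ℝ, |t| = T → ∀ σ : ℝ, σ₀ ≤ σ → σ ≤ c →
      ‖(fun s ↦ (χ.LFunction s)⁻¹) (σ + t * I)‖ * x' ^ σ ≤ W := by
    intro t ht σ hσ1 hσ2
    rw [hW]
    exact horizontal_le χ hχ hη0 hη4 ha0 ha4 (hdisc t ht.le) (hMt t ht.le) hcη hx'0 hlog4M hlx2 hηL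
      (by linarith only [hKℓ5]) (by rw [hx']; linarith only [hN3r]) hx'c
      (by rw [hσ₀] at hσ1; exact hσ1) hσ2
  have main := hPerron _ (norm_twist_moebius_le χ) N hN3 x' c hx' hc T σ₀ hT1 hσ₀0 hσ₀1 _ hFd hLF
    _ W (fun t ht ↦ by
      have h := norm_inv_left_le χ hχ hη0 hη4 ha0 ha4 (hdisc t ht) (hMt t ht) hcη
      rw [← hσ₀] at h; exact h)
    (hWb T (abs_of_pos hT0)) (fun σ h1 h2 ↦ by
      have := hWb (-T) (by rw [abs_neg, abs_of_pos hT0]) σ h1 h2; push_cast at this; exact this)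
  -- the three pieces
  have hP1 := piece_one hH hB hLexp hTdef hK₀L hK₀0 hx'0 hlx2 hℓpos
  have hE2' : H * ℓ + (4 * a + 2) * Mb + 4 * (ℓ + 12) - K * ℓ / 5 + (B + 1) * ℓ ≤ 0 := by
    rw [hMb]; exact hE2
  have hP2 := piece_two hTdef rfl hσ₀ hσ₀0 hσ₀2 hx'0 hlx1 hηL hη0 hE2'
  have hP3 := piece_three hTdef hW hc hσ₀ hlx1 hL0 hLexp hηL hKℓ5 hx'0 hE3
  have hfin := final_step (B := B) hx' hN3r hL16 hLexp hL0
  rw [← hLdef]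
  linarith only [main, hP1, hP2, hP3, hfin]

end MoebiusCharSumLinnikBox

end Literature.NumberTheory.LFunctions

end
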